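import Literature.Analysis.FunctionSpaces.TorusCalculus
import Literature.Analysis.FunctionSpaces.TorusTestFunction
import Literature.Analysis.FluidPDE.LagrangianLatticeCarrier
import HarnessLib

/-!
# Pushforward of weakly divergence-free fields by measure-preserving displacement maps of the torus

Helper file for the Lagrangian cone of route `SolenoidalFractalHomogenisation` (K3L `LagrangianCarrierConstruction`,
stmt-AnomalousDissipation-24913, stubs `stub_flowsL` / `stub_regularL`: clause (L2) of `LagrangianLatticeCarrier.LevelRegular`, planner
ruling R22-1).  Armstrong–Vicol insert level `m+1` in the Lagrangian coordinates of the coarse flow (arXiv:2305.05048 §2.2, PDF p. 18):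
`b_{m+1}(t, X y) = DX(y) · v_{m+1}(t, y)` — in the tree `E.b (m+1) t (E.X m t w y) = E.flowDeriv m t w y (level (m+1) t y)`
(`LagrangianLatticeCarrier.IsInserted`), with `X x = x + proj (disp x)` and `flowDeriv = id + D(lift disp)(repr y)`.  The inserted level is
again weakly divergence free because the flow map preserves volume.  This file proves that fact for a general DISPLACEMENT MAP
`S x = x + proj (u x)` of `𝕋ᵈ` with `u` smooth:

* chain rule on the torus: `D(θ ∘ S)(y) = Dθ(S y) ∘ (id + Du(y))` (`fderiv_comp_displacement`), smoothness of `θ ∘ S`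
  (`isSmooth_comp_displacement`), and the duality `⟪(id + Du(y)) w, ∇θ(S y)⟫ = ⟪w, ∇(θ ∘ S)(y)⟫` (`inner_pushforward_gradient`);
* **`isWeaklyDivFree_pushforward`**: if `S` is measure preserving, `v` is weakly divergence free and a measurable field `b` satisfies the
  insertion identity `b (S y) = (id + Du(y)) (v y)`, then `b` is weakly divergence free
  (`∫⟪b, ∇θ⟫ = ∫⟪b∘S, ∇θ∘S⟫ = ∫⟪v, ∇(θ∘S)⟫ = 0`);
* the same with the derivative written as in `LagrangianLatticeCarrier.flowDeriv`, `id + D(lift u)(repr y)`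
  (`isWeaklyDivFree_pushforward_flowDeriv`), and the instance for a Lagrangian lattice carrier
  (`isWeaklyDivFree_of_insertion`: a field inserted along `E.X m t w` from a weakly divergence-free field is weakly divergence free as
  soon as `disp m t w` is smooth and `X m t w` preserves volume).

No definitions, no named facts, no sorry; rung-leaf bookkeeping only.  Prover seat `ad-solenoidal-k2r-lowerlaw-p1` g5, 2026-08-28.
-/

set_option linter.dupNamespace false

noncomputable section

namespace Summit.AnomalousDissipation.AnomalousDissipation.Theorems.SolenoidalFractalHomogenisation.LagrangianCarrier

open Set Filter Topology MeasureTheory Function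
open scoped InnerProductSpace
open Literature.Analysis Literature.Analysis.FunctionSpaces Literature.Analysis.FunctionSpaces.Torus
open Literature.Analysis.FluidPDE Literature.Analysis.FluidPDE.LatticeShear

section Displacement

variable {d : Type*} [Fintype d]

omit [Fintype d] in
/-- The re-centred lift of `θ ∘ S`, `S x = x + proj (u x)`: `liftAt (θ ∘ S) y = liftAt θ y ∘ (v ↦ v + liftAt u y v)`. [folklore] -/
theorem liftAt_comp_displacement {F : Type*} (θ : UnitAddTorus d → F) (u : UnitAddTorus d → EuclideanSpace ℝ d)
    (y : UnitAddTorus d) :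
    liftAt (fun x => θ (x + proj (u x))) y = liftAt θ y ∘ fun v => v + liftAt u y v := by
  funext v
  simp only [liftAt_apply, Function.comp_apply, proj_add, add_assoc]

omit [Fintype d] in
/-- The re-centred lift at the displaced point: `liftAt θ (S y) = liftAt θ y ∘ (w ↦ u y + w)`. [folklore] -/
theorem liftAt_displaced {F : Type*} (θ : UnitAddTorus d → F) (u : UnitAddTorus d → EuclideanSpace ℝ d)
    (y : UnitAddTorus d) :
    liftAt θ (y + proj (u y)) = liftAt θ y ∘ fun w => u y + w := by
  funext w
  simp only [liftAt_apply, Function.comp_apply, proj_add, add_assoc]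

/-- **`θ ∘ S` is smooth** for `θ` smooth and a smooth displacement `u` (`lift (θ ∘ S) = lift θ ∘ (id + lift u)`). [folklore] -/
theorem isSmooth_comp_displacement {F : Type*} [NormedAddCommGroup F] [NormedSpace ℝ F] {θ : UnitAddTorus d → F}
    (hθ : IsSmooth θ) {u : UnitAddTorus d → EuclideanSpace ℝ d} (hu : IsSmooth u) :
    IsSmooth (fun x => θ (x + proj (u x))) := by
  have e : lift (fun x => θ (x + proj (u x))) = lift θ ∘ fun y => y + lift u y := by
    funext y
    simp only [lift_apply, Function.comp_apply, proj_add]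
  change ContDiff ℝ ((⊤ : ℕ∞) : WithTop ℕ∞) (lift (fun x => θ (x + proj (u x))))
  rw [e]
  exact hθ.comp (contDiff_id.add hu)

/-- **Chain rule on the torus for a displacement map**: `D(θ ∘ S)(y) = Dθ(S y) ∘ (id + Du(y))` (torus Fréchet derivatives,
`Torus.fderiv`). [folklore] -/
theorem fderiv_comp_displacement {F : Type*} [NormedAddCommGroup F] [NormedSpace ℝ F] {θ : UnitAddTorus d → F}
    (hθ : IsSmooth θ) {u : UnitAddTorus d → EuclideanSpace ℝ d} (hu : IsSmooth u) (y : UnitAddTorus d) :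
    Torus.fderiv (fun x => θ (x + proj (u x))) y =
      (Torus.fderiv θ (y + proj (u y))).comp (ContinuousLinearMap.id ℝ (EuclideanSpace ℝ d) + Torus.fderiv u y) := by
  have htop : ((⊤ : ℕ∞) : WithTop ℕ∞) ≠ 0 := by simp
  have hθd : Differentiable ℝ (liftAt θ y) := (hθ.liftAt y).differentiable htop
  have hud : Differentiable ℝ (liftAt u y) := (hu.liftAt y).differentiable htop
  have hh : DifferentiableAt ℝ (fun v : EuclideanSpace ℝ d => v + liftAt u y v) 0 :=
    differentiableAt_id.add (hud 0)
  have h0 : (0 : EuclideanSpace ℝ d) + liftAt u y 0 = u y := by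
    simp [liftAt_apply, proj_zero]
  unfold Torus.fderiv
  rw [liftAt_comp_displacement, _root_.fderiv_comp 0 (hθd _) hh, h0]
  congr 1
  · -- `D(liftAt θ y)(u y) = D(liftAt θ (S y))(0)`
    rw [liftAt_displaced θ u y]
    show _ = _root_.fderiv ℝ (fun w => liftAt θ y (u y + w)) 0
    rw [fderiv_comp_add_left, add_zero]
  · exact ((hasFDerivAt_id (𝕜 := ℝ) (0 : EuclideanSpace ℝ d)).add (hud 0).hasFDerivAt).fderiv

/-- **Duality of the pushforward and the gradient**: `⟪(id + Du(y)) w, ∇θ (S y)⟫ = ⟪w, ∇(θ ∘ S)(y)⟫`. [folklore] -/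
theorem inner_pushforward_gradient {θ : UnitAddTorus d → ℝ} (hθ : IsSmooth θ)
    {u : UnitAddTorus d → EuclideanSpace ℝ d} (hu : IsSmooth u) (y : UnitAddTorus d) (w : EuclideanSpace ℝ d) :
    ⟪(ContinuousLinearMap.id ℝ (EuclideanSpace ℝ d) + Torus.fderiv u y) w, Torus.gradient θ (y + proj (u y))⟫_ℝ =
      ⟪w, Torus.gradient (fun x => θ (x + proj (u x))) y⟫_ℝ := by
  rw [real_inner_comm, Torus.gradient, inner_gradient_left, real_inner_comm, Torus.gradient, inner_gradient_left]
  change Torus.fderiv θ (y + proj (u y)) _ = Torus.fderiv (fun x => θ (x + proj (u x))) y w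
  rw [fderiv_comp_displacement hθ hu y]
  rfl

/-- **Pushforward of a weakly divergence-free field by a measure-preserving displacement map is weakly divergence free.**
`S x = x + proj (u x)` with `u` smooth and `S` measure preserving; `v` weakly divergence free; `b` measurable with the insertion identity
`b (S y) = (id + Du(y)) (v y)` for all `y`.  Then `∫⟪b, ∇θ⟫ = ∫⟪b ∘ S, ∇θ ∘ S⟫ = ∫⟪v, ∇(θ ∘ S)⟫ = 0` for every smooth `θ`.
[cite: ArmstrongVicol2025, §2.2 (PDF p. 18: the inserted levels are divergence free, the flows being volume preserving)] -/
theorem isWeaklyDivFree_pushforward {u : UnitAddTorus d → EuclideanSpace ℝ d} (hu : IsSmooth u)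
    (hS : MeasurePreserving (fun x : UnitAddTorus d => x + proj (u x)) volume volume)
    {v b : UnitAddTorus d → EuclideanSpace ℝ d} (hv : IsWeaklyDivFree v) (hbm : AEStronglyMeasurable b volume)
    (hb : ∀ y, b (y + proj (u y)) = (ContinuousLinearMap.id ℝ (EuclideanSpace ℝ d) + Torus.fderiv u y) (v y)) :
    IsWeaklyDivFree b := by
  intro θ hθ
  have hθS : IsSmooth (fun x => θ (x + proj (u x))) := isSmooth_comp_displacement hθ hu
  -- change of variables along the measure-preserving map `S`
  have hmeas : AEStronglyMeasurable (fun x => ⟪b x, Torus.gradient θ x⟫_ℝ)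
      (Measure.map (fun x : UnitAddTorus d => x + proj (u x)) volume) := by
    rw [hS.map_eq]
    exact hbm.inner hθ.gradient.continuous.aestronglyMeasurable
  have h1 : ∫ x, ⟪b x, Torus.gradient θ x⟫_ℝ =
      ∫ y, ⟪b (y + proj (u y)), Torus.gradient θ (y + proj (u y))⟫_ℝ := by
    have h := integral_map hS.measurable.aemeasurable hmeas
    rw [hS.map_eq] at h
    exact h
  rw [h1]
  simp_rw [hb, inner_pushforward_gradient hθ hu]
  exact hv _ hθS

/-- The same with the derivative of the displacement written on the global lift at a representative, as in
`LagrangianLatticeCarrier.flowDeriv`: `id + D(lift u)(repr y)`. [cite: ArmstrongVicol2025, §2.2 (PDF p. 18)] -/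
theorem isWeaklyDivFree_pushforward_flowDeriv [DecidableEq d] {u : UnitAddTorus d → EuclideanSpace ℝ d} (hu : IsSmooth u)
    (hS : MeasurePreserving (fun x : UnitAddTorus d => x + proj (u x)) volume volume)
    {v b : UnitAddTorus d → EuclideanSpace ℝ d} (hv : IsWeaklyDivFree v) (hbm : AEStronglyMeasurable b volume)
    (hb : ∀ y, b (y + proj (u y)) = (ContinuousLinearMap.id ℝ (EuclideanSpace ℝ d) + _root_.fderiv ℝ (lift u) (repr y)) (v y)) :
    IsWeaklyDivFree b := by
  refine isWeaklyDivFree_pushforward hu hS hv hbm fun y => ?_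
  rw [hb y, fderiv_lift, proj_repr]

end Displacement

section Carrier

variable {k : ℕ}

/-- **Inserted levels are weakly divergence free.**  For a Lagrangian lattice carrier `E`, a level `m`, times `t, w`: if the
displacement `E.disp m t w` is smooth and the flow map `E.X m t w` preserves volume (clauses (F1)/(F2) of `LevelRegular`, which the
construction knows for its explicit shear compositions), then any measurable field `b'` inserted along it from a weakly divergence-free
field `v` — `b' (E.X m t w y) = E.flowDeriv m t w y (v y)` for all `y`, as in `IsInserted` with `v = level (m+1) t` — is weakly
divergence free. [cite: ArmstrongVicol2025, §2.2 (PDF p. 18: b_m divergence free)] -/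
theorem isWeaklyDivFree_of_insertion (E : LagrangianLatticeCarrier k) (m : ℕ) (t w : ℝ)
    (hdisp : IsSmooth (E.disp m t w)) (hX : MeasurePreserving (E.X m t w) volume volume)
    {v b' : UnitAddTorus (Fin 3) → EuclideanSpace ℝ (Fin 3)} (hv : IsWeaklyDivFree v) (hbm : AEStronglyMeasurable b' volume)
    (hb : ∀ y, b' (E.X m t w y) = E.flowDeriv m t w y (v y)) : IsWeaklyDivFree b' := by
  have hX' : MeasurePreserving (fun x : UnitAddTorus (Fin 3) => x + proj (E.disp m t w x)) volume volume := by
    have e : (fun x : UnitAddTorus (Fin 3) => x + proj (E.disp m t w x)) = E.X m t w := by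
      funext x
      rw [LagrangianLatticeCarrier.X_apply]
    rw [e]
    exact hX
  refine isWeaklyDivFree_pushforward_flowDeriv hdisp hX' hv hbm fun y => ?_
  have h := hb y
  rw [LagrangianLatticeCarrier.X_apply] at h
  rw [h, LagrangianLatticeCarrier.flowDeriv]

end Carrier

end Summit.AnomalousDissipation.AnomalousDissipation.Theorems.SolenoidalFractalHomogenisation.LagrangianCarrier

end
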